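/-
Origin: expansion seat `planner-pub-hodgecm-qw8-g11-0`, handover #17 SPLIT PART 2/2 = REPLACE tree `HodgeCM/Model/Toy/LefQuadMixed.lean` 1602351a (484 l.) by md5 ef1f3ff2850ae4b47dd6bf6ac75b2bf4 (260 l.): keeps the module name + module docstring, its earlier sections moved verbatim to rows #16..#16 (LefQuadMixedEngine); ONE rewrite: `import Qw8g11.LefQuadMixedEngine` -> `import HodgeCM.Model.Toy.LefQuadMixedEngine` (row #16); union of the parts' comment-strippe (`HOME/pub-hodgecm-qw8-g11/lean/Qw8g11/LefQuadMixed.lean`, md5 ef1f3ff2, 260 lines);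
landed by the packager successor (mc-unitary-1-g3, gen-8 kit) in gate run 32 REPLACES the earlier landed copy of `HodgeCM/Model/Toy/LefQuadMixed.lean` (import ^import Qw8g11\.LefQuadMixedEngine[ \t]*$→import HodgeCM.Model.Toy.LefQuadMixedEngine ×1).
-/
-- HANDOVER (planner-pub-hodgecm-qw8-g11-0, unit pub-hodgecm-qw8-g11): SPLIT PART 2/2 = REPLACEMENT of the installed
-- `HodgeCM.Model.Toy.LefQuadMixed` (md5 1602351a, 484 l.): §§4–6 (ll. 277–480) verbatim + docstrings; §§1–3 moved to
-- `LefQuadMixedEngine`; at landing rewrite `import Qw8g11.LefQuadMixedEngine` ↦ `import HodgeCM.Model.Toy.LefQuadMixedEngine`.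
/-
Copyright (c) 2026. All rights reserved.
Released under Apache 2.0 license as described in the file LICENSE.
-/
import Summits.HodgeConjecture.HodgeCM.Model.Toy.LefQuadMixedEngine

/-!
# The Lefschetz model on products with CM types of imaginary-quadratic reflex (mixed CM fields)

(Split for the 400-line cap: §§1–3 of this file — `Obj.Omega`, the signs `sg`, and the engine `TriOmega ⇒ CntBal` — are now
the module `HodgeCM.Model.Toy.LefQuadMixedEngine`, imported here; §§4–6 below are unchanged.)

`LefQuartic` proved `lefModel ⊨ HC` for every product of CM abelian varieties whose CM types are induced
from ONE CM field `K` of degree `≤ 4`, by summing sign vectors over the finite Galois image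
`Ω_K ⊆ Sym(Hom(K,ℂ))`.  Here the one-field hypothesis is removed on the imaginary-quadratic side: the sums
run over the Galois image `Ω_X ⊆ (X.Idx → X.Idx)` on the eigen-indices of the object itself (§1), the engine
`TriOmega X ⇒ CntBal X` (§3: pairwise inner products of slot sign vectors are `0` or `±#Ω_X`) is the
object-level form of `LefQuartic` §8, and §4 feeds it from SIGN CHARACTERS: if `Aut_ℚ(ℚ̄)` moves the CM
type of every atom only to itself or to its conjugate (`SignChar X` — equivalently every atom's CM type has
imaginary-quadratic reflex, i.e. is induced from an imaginary quadratic subfield, §5), then two slot sign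
vectors differ by a `±1`-valued multiplicative factor, whose sum over the group image is `0` unless the
factor is trivial.

HEADLINE `lef_hc_prodFin_induceType_quad`: for imaginary quadratic fields `k₀, …, kₙ` (not necessarily
equal or distinct), arbitrary CM fields `Fᵢ ⊇ kᵢ` and CM types `Φᵢ` of `Fᵢ` induced from `kᵢ`,
`lefModel ⊨ HC(A_{(F₀,Φ₀)} × ⋯ × A_{(Fₙ,Φₙ)})` in every degree — e.g. every product of CM elliptic curves with
arbitrary (mixed) CM fields (`lef_hc_prodFin_cmObj_quad`), and every product of `E^g`-type CM abelian
varieties.  (Two different QUARTIC fields do not mix: a primitive quartic type and its reflex give inner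
product `±#Ω/2`, cf. `HOME/pub-hodgecm-qw8-g8/LEFQUARTIC.md` §7.)
Nothing is cited: kernel facts about an explicit model.
-/

noncomputable section

set_option backward.isDefEq.respectTransparency false

namespace HodgeCM.Toy

open scoped TensorProduct
open exteriorPower Module CMPresentation CMTypeOps
open NumberField.ComplexEmbedding (conjugate)
open Literature.AlgebraicGeometry.Motives

namespace Obj

variable (X : Obj)

/-! ### 4. Sign characters give the trichotomy -/

section SignChar

open scoped Classical

/-- **sign characters at an atom `i`**: `Aut_ℚ(ℚ̄)` moves the CM type of the atom only to itself or to
its conjugate — for every `γ` there is one `ε` (necessarily `±1`) with `sg(γ • (i,τ)) = ε · sg(i,τ)` for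
ALL `τ ∈ Hom(F_i, ℂ)`. -/
def SignCharAt (i : X.s.toType) : Prop :=
  ∀ γ : Gam, ∃ ε : ℤ, ∀ τ : (X.atom i).F →+* ℂ, X.sg (X.gact γ ⟨i, τ⟩) = ε * X.sg ⟨i, τ⟩

/-- … at every atom -/
def SignChar : Prop := ∀ i : X.s.toType, X.SignCharAt i

/-- **sign characters at the atoms of two slots give the trichotomy for that pair.** The summand
`sg(ω s) sg(ω t)` is multiplied by `ε_s(γ) ε_t(γ) = ±1` under
`ω ↦ γ ∘ ω`, a bijection of `Ω_X`; if that factor is `-1` for some `γ` the sum vanishes, otherwise the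
summand is constant `= sg(s) sg(t) = ±1`. -/
theorem trichot_of_signCharAt {s t : X.Idx} (hs : X.SignCharAt s.1) (ht : X.SignCharAt t.1) :
    Trichot X.Omega.card (∑ ω ∈ X.Omega, X.sg (ω s) * X.sg (ω t)) := by
  choose εs hεs using hs
  choose εt hεt using ht
  -- `ε` is `±1`-valued where it matters
  have hεs' : ∀ γ : Gam, εs γ = X.sg (X.gact γ s) * X.sg s := fun γ => by
    have h1 : X.sg (X.gact γ s) = εs γ * X.sg s := hεs γ s.2
    rw [h1, mul_assoc, sg_mul_self, mul_one]
  have hεt' : ∀ γ : Gam, εt γ = X.sg (X.gact γ t) * X.sg t := fun γ => by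
    have h1 : X.sg (X.gact γ t) = εt γ * X.sg t := hεt γ t.2
    rw [h1, mul_assoc, sg_mul_self, mul_one]
  have hεpm : ∀ γ : Gam, εs γ * εt γ = 1 ∨ εs γ * εt γ = -1 := fun γ => by
    rw [hεs', hεt']
    rcases X.sg_eq_or (X.gact γ s) with h1 | h1 <;> rcases X.sg_eq_or s with h2 | h2 <;>
      rcases X.sg_eq_or (X.gact γ t) with h3 | h3 <;> rcases X.sg_eq_or t with h4 | h4 <;>
        simp only [h1, h2, h3, h4] <;> norm_num
  -- multiplicativity of the summand under `ω ↦ γ ∘ ω`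
  have hmul : ∀ (γ : Gam), ∀ ω ∈ X.Omega, X.sg (X.gact γ (ω s)) * X.sg (X.gact γ (ω t))
      = (εs γ * εt γ) * (X.sg (ω s) * X.sg (ω t)) := by
    intro γ ω hω
    obtain ⟨δ, rfl⟩ := mem_Omega.mp hω
    have hs : X.sg (X.gact γ (X.gact δ s)) = εs γ * X.sg (X.gact δ s) := hεs γ (X.gact δ s).2
    have ht : X.sg (X.gact γ (X.gact δ t)) = εt γ * X.sg (X.gact δ t) := hεt γ (X.gact δ t).2
    rw [hs, ht]; ring
  by_cases hA : ∃ γ : Gam, εs γ * εt γ = -1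
  · -- a non-trivial factor: the sum vanishes
    obtain ⟨γ, hγ⟩ := hA
    left
    have h1 := X.sum_Omega_comp γ fun ω => X.sg (ω s) * X.sg (ω t)
    have h2 : ∑ ω ∈ X.Omega, X.sg (X.gact γ (ω s)) * X.sg (X.gact γ (ω t))
        = -∑ ω ∈ X.Omega, X.sg (ω s) * X.sg (ω t) := by
      rw [← Finset.sum_neg_distrib]
      exact Finset.sum_congr rfl fun ω hω => by rw [hmul γ ω hω, hγ]; ring
    rw [h2] at h1
    linarith
  · -- trivial factor: the summand is constant
    push Not at hA
    have hone : ∀ γ : Gam, εs γ * εt γ = 1 := fun γ => (hεpm γ).resolve_right (hA γ)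
    have hconst : ∀ ω ∈ X.Omega, X.sg (ω s) * X.sg (ω t) = X.sg s * X.sg t := by
      intro ω hω
      obtain ⟨γ, rfl⟩ := mem_Omega.mp hω
      have h1 := hmul γ (X.gact 1) (X.gact_mem_Omega 1)
      rw [gact_one, gact_one, hone γ, one_mul] at h1
      exact h1
    rw [Finset.sum_congr rfl hconst, Finset.sum_const, nsmul_eq_mul]
    rcases X.sg_eq_or s with h1 | h1 <;> rcases X.sg_eq_or t with h2 | h2
    · right; left; rw [h1, h2]; ring
    · right; right; rw [h1, h2]; ring
    · right; right; rw [h1, h2]; ring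
    · right; left; rw [h1, h2]; ring

/-- **`SignChar ⇒ TriOmega`.** -/
theorem triOmega_of_signChar (h : X.SignChar) : X.TriOmega := fun s t =>
  X.trichot_of_signCharAt (h s.1) (h t.1)

end SignChar

/-! ### 5. Atoms with sign characters: CM types induced from an imaginary quadratic field -/

section Quad

open scoped Classical

/-- the atom `i` of `X` is presented over SOME imaginary quadratic field: its CM type is induced from a
CM type `Ψ` of an imaginary quadratic subfield `e : k ↪ F_i` (equivalently, the atom's CM type has
imaginary-quadratic reflex field — the `E^g`-type); in `QuadPresented` the `k` may differ from atom to
atom -/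
def QuadPresentedAt (i : X.s.toType) : Prop :=
  ∃ (k : CMField) (_ : Module.finrank ℚ k = 2) (Ψ : CMType k) (e : k →+* (X.atom i).F),
    ∀ τ : (X.atom i).F →+* ℂ, τ ∈ (X.atom i).Φ ↔ τ.comp e ∈ Ψ.1

/-- … at every atom -/
def QuadPresented : Prop := ∀ i : X.s.toType, X.QuadPresentedAt i

/-- the Galois action on eigen-indices restricts along a subfield to the `twist` action on its embeddings -/
theorem gact_snd_comp {k : Type} [Field k] [NumberField k] (γ : Gam) {i : X.s.toType}
    (τ : (X.atom i).F →+* ℂ) (e : k →+* (X.atom i).F) :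
    (X.gact γ ⟨i, τ⟩).2.comp e = twist γ (τ.comp e) :=
  RingHom.ext fun x => by
    rw [RingHom.comp_apply, gact_snd_apply, twist_apply]
    exact congrArg (fun z : Qbar => ((γ z : Qbar) : ℂ)) (Subtype.ext rfl)

/-- over an imaginary quadratic field an automorphism fixes both embeddings or conjugates both -/
theorem twist_eq_self_or_conjugate (k : CMField) (hk : Module.finrank ℚ k = 2) (Ψ : CMType k) (γ : Gam) :
    (∀ φ : k →+* ℂ, twist γ φ = φ) ∨ (∀ φ : k →+* ℂ, twist γ φ = conjugate φ) := by
  by_cases hfix : ∀ φ : k →+* ℂ, twist γ φ = φ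
  · exact Or.inl hfix
  right
  push Not at hfix
  obtain ⟨φ₀, hφ₀⟩ := hfix
  intro φ
  rcases eq_or_of_finrank_eq_two Ψ hk φ (twist γ φ) with h1 | h1
  · exfalso
    apply hφ₀
    rcases eq_or_of_finrank_eq_two Ψ hk φ φ₀ with h2 | h2
    · rw [h2, h1]
    · rw [h2, twist_conjugate, h1]
  · exact h1

/-- **a quadratic-presented atom has sign characters** -/
theorem signCharAt_of_quadPresentedAt {i : X.s.toType} (h : X.QuadPresentedAt i) : X.SignCharAt i := by
  intro γ
  obtain ⟨k, hk, Ψ, e, he⟩ := h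
  have hhol : ∀ (δ : Gam) (τ : (X.atom i).F →+* ℂ), X.hol (X.gact δ ⟨i, τ⟩) ↔ twist δ (τ.comp e) ∈ Ψ.1 := by
    intro δ τ
    show (X.gact δ ⟨i, τ⟩).2 ∈ (X.atom i).Φ ↔ _
    rw [he, gact_snd_comp]
  have hhol0 : ∀ τ : (X.atom i).F →+* ℂ, X.hol ⟨i, τ⟩ ↔ τ.comp e ∈ Ψ.1 := fun τ => he τ
  rcases twist_eq_self_or_conjugate k hk Ψ γ with hfix | hmove
  · refine ⟨1, fun τ => ?_⟩
    have hiff : X.hol (X.gact γ ⟨i, τ⟩) ↔ X.hol ⟨i, τ⟩ := by rw [hhol, hfix, hhol0]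
    rw [one_mul]
    by_cases hm : X.hol ⟨i, τ⟩
    · rw [sg_of_hol hm, sg_of_hol (hiff.mpr hm)]
    · rw [sg_of_not_hol hm, sg_of_not_hol (fun h' => hm (hiff.mp h'))]
  · refine ⟨-1, fun τ => ?_⟩
    have hiff : X.hol (X.gact γ ⟨i, τ⟩) ↔ ¬ X.hol ⟨i, τ⟩ := by
      rw [hhol, hmove, hhol0]
      exact conjugate_mem_iff_notMem Ψ (τ.comp e)
    by_cases hm : X.hol ⟨i, τ⟩
    · rw [sg_of_hol hm, sg_of_not_hol (fun h' => hiff.mp h' hm)]; norm_num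
    · rw [sg_of_not_hol hm, sg_of_hol (hiff.mpr hm)]; norm_num

/-- **quadratic-presented objects have sign characters** … -/
theorem signChar_of_quadPresented (h : X.QuadPresented) : X.SignChar := fun i =>
  X.signCharAt_of_quadPresentedAt (h i)

/-- … so satisfy `CntBal` … -/
theorem cntBal_of_quadPresented (h : X.QuadPresented) : X.CntBal :=
  X.cntBal_of_triOmega (X.triOmega_of_signChar (X.signChar_of_quadPresented h))

end Quad

end Obj

/-! ### 6. Headlines: products over mixed imaginary-quadratic CM data -/

section HeadlineQuad

/-- `QuadPresented` is preserved by the product `X.prod Y` -/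
theorem quadPresented_prod {X Y : Obj} (hX : X.QuadPresented) (hY : Y.QuadPresented) :
    (X.prod Y).QuadPresented := by
  rintro (i | i)
  · exact hX i
  · exact hY i

/-- `QuadPresented` is preserved by the iterated product `prodFin` of `toyModelWith D` -/
theorem quadPresented_prodFin (D : HodgeData) : ∀ (n : ℕ) (Xs : Fin (n + 1) → Obj),
    (∀ j, (Xs j).QuadPresented) → Obj.QuadPresented ((toyModelWith D).prodFin n Xs)
  | 0, _, h => h 0
  | n + 1, _, h => quadPresented_prod (quadPresented_prodFin D n _ fun _ => h _) (h _)

/-- `A_{(F,Φ)}` with `Φ` induced from an imaginary quadratic `k ↪ F` is quadratic-presented … -/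
theorem quadPresented_cmObj_induceType (k : CMField) (hk : Module.finrank ℚ k = 2) {F : CMField}
    (e : k →+* F) (Ψ : CMType k) : (cmObj F (induceType e Ψ)).QuadPresented :=
  fun _ => ⟨k, hk, Ψ, (eK F : F →+* FK F).comp e, fun _ => Iff.rfl⟩

/-- … as is a CM elliptic curve `A_{(k,Ψ)}` -/
theorem quadPresented_cmObj (k : CMField) (hk : Module.finrank ℚ k = 2) (Ψ : CMType k) :
    (cmObj k Ψ).QuadPresented :=
  fun _ => ⟨k, hk, Ψ, (eK k : k →+* FK k), fun _ => Iff.rfl⟩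

/-- **HC in the Lefschetz model for every quadratic-presented object.** -/
theorem lef_hc_of_quadPresented (X : Obj) (h : X.QuadPresented) : lefModel.HC X :=
  lef_hc_of_cntBal X (X.cntBal_of_quadPresented h)

/-- **HEADLINE (mixed imaginary-quadratic CM data).** For imaginary quadratic fields `k₀, …, kₙ` (equal or
not), arbitrary CM fields `Fᵢ` with embeddings `eᵢ : kᵢ →+* Fᵢ` and CM types `Ψᵢ` of `kᵢ`, every Hodge
class of every degree on `A_{(F₀, Φ₀)} × ⋯ × A_{(Fₙ, Φₙ)}`, `Φᵢ = induceType eᵢ Ψᵢ`, is `lefModel`-algebraic. -/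
theorem lef_hc_prodFin_induceType_quad {n : ℕ} (k : Fin (n + 1) → CMField)
    (hk : ∀ i, Module.finrank ℚ (k i) = 2) (F : Fin (n + 1) → CMField) (e : ∀ i, k i →+* F i)
    (Ψ : ∀ i, CMType (k i)) :
    lefModel.HC (lefModel.prodFin n fun i => cmObj (F i) (induceType (e i) (Ψ i))) := by
  rw [lefModel_prodFin]
  exact lef_hc_of_quadPresented _ (quadPresented_prodFin exteriorHodgeData n _ fun i =>
    quadPresented_cmObj_induceType (k i) (hk i) (e i) (Ψ i))

/-- in particular **every product of CM elliptic curves, with arbitrary (mixed) CM fields, satisfies HC in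
the Lefschetz model** in every degree -/
theorem lef_hc_prodFin_cmObj_quad {n : ℕ} (k : Fin (n + 1) → CMField)
    (hk : ∀ i, Module.finrank ℚ (k i) = 2) (Ψ : ∀ i, CMType (k i)) :
    lefModel.HC (lefModel.prodFin n fun i => cmObj (k i) (Ψ i)) := by
  rw [lefModel_prodFin]
  exact lef_hc_of_quadPresented _ (quadPresented_prodFin exteriorHodgeData n _ fun i =>
    quadPresented_cmObj (k i) (hk i) (Ψ i))

end HeadlineQuad

end HodgeCM.Toy

end
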